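import Summits.QuantumFields.BalabanUV.T4Continuum.Spine.NE2.ComposedRemainderTower

/-!
# T⁴ programme, spine node NE2 (U1a) — R14 W3 proper, file 4: NON-VACUITY / CONSISTENCY WITNESS — AT FLAT COEFFICIENTS THE COMPOSED REMAINDER VANISHES IDENTICALLY
# (cell `pub-balaban-gaps`, seat ne2 gen 5; companion of `ComposedRemainderTower`)

[B7] p. 36: «the functions g(−z), g⁻¹(z), e^{iz} are equal to 1 for z = 0» — at a FLAT background (`Y = Y_x = 0`) the three coefficient operators of (124)'s remainder vanish and `Q(V₀) = Q₀`.
THIS FILE records the tower form of that remark for the constructed objects of file 3: with the flat coefficient data **`flatCoeff`** (`G₁ = G₂ = G₃ = 0`, `R̄_{0,c} = 1`) and ANY data tower `W`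
of fine transporters, every one-step remainder vanishes (`QremStep_flatCoeff`), hence by the recursion `Erem_succ` the composed remainder vanishes at every level (**`Erem_flatCoeff`**) and the
composed FULL averaging is exactly the composed main-term table averaging: `√(n_k^d)·Q^{full}_k = B_k + E_k(T_Bal)` (**`sqrtVol_smul_QfullLev_flatCoeff`**).  In particular the hypotheses of
file 3's size law `opNorm_Erem_le` are jointly satisfiable (coefficient letters `γ_i = 0`), and at `W ≡ 1` the whole remainder tower of `ComposedAveragingRemainder.avgPertFull` is the free one
(`Erem_one_flatCoeff`, with gen 3's `TBal_one`).
HONEST FRAMING (T4-DAG p. 1).  Bookkeeping about typed operator shapes; NOT NE2, NOT [B7] (124) beyond the displayed reading; **NE2 (U1a) NOT PROVED**; spine PROVED 0/9 unchanged; NOT continuum YM /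
infinite volume / mass gap / Clay.  HONEST DEPENDENCY: continuum YM on T⁴ ⇐ BetaPertH ∧ nine spine estimates (0/9 proved); BetaPertH ⇐ (D1) ∧ (D4) ∧ CAP+tail.  No `sorry`.
-/

noncomputable section

open scoped BigOperators ComplexConjugate Matrix Matrix.Norms.L2Operator Kronecker

namespace Summit.QuantumFields.BalabanUV.T4Continuum.NE2.ComposedRemainderFlatWitness

open Literature.MathematicalPhysics.QuantumFieldTheory.Balaban1983to89.B5Prop11Plancherel (Tor fine)
open Literature.MathematicalPhysics.QuantumFieldTheory.Balaban1983to89.B5G183RateUnitTower (lev lev_neZero)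
open Summit.QuantumFields.BalabanUV.T4Continuum
open Summit.QuantumFields.BalabanUV.T4Continuum.BalabanAveragedTowerUnit (idx)
open Summit.QuantumFields.BalabanUV.T4Continuum.CovariantBlockAveraging (sqrtVol Bfree)
open Summit.QuantumFields.BalabanUV.T4Continuum.NE2.CovariantTableTower (EcovT)
open Summit.QuantumFields.BalabanUV.T4Continuum.NE2.CovariantTableBalaban (TBal)
open Summit.QuantumFields.BalabanUV.T4Continuum.NE2.OneStepRemainder (Qrem_zero_coeff)
open Summit.QuantumFields.BalabanUV.T4Continuum.NE2.ComposedRemainderTower (RemCoeff QremStep QmainStep QfullLev Erem Erem_zero Erem_succ Bfree_add_EcovT_add_Erem)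

variable {d : ℕ} (L : ℕ) [NeZero L] (M : Fin d → ℕ) [hM : ∀ μ, NeZero (M μ)] {o : Type*} [Fintype o] [DecidableEq o]

variable (d) (o) in
/-- **FLAT COEFFICIENT DATA**: `G₁ = G₂ = G₃ = 0` (print: `g(0) = 1`, `e^0 = 1`) and `R̄_{0,c} = 1`. [folklore] -/
def flatCoeff : RemCoeff d L M o where
  G₁ := fun _ _ _ _ => 0
  G₂ := fun _ _ _ _ => 0
  G₃ := fun _ _ _ => 0
  Rc := fun _ _ _ => 1

omit hM in
/-- at flat coefficients every one-step remainder vanishes, for any fine transporters. [folklore] -/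
theorem QremStep_flatCoeff (W : (i : ℕ) → Fin d → (idx L M i → Matrix o o ℂ)) (k : ℕ) : QremStep L M W (flatCoeff d L M o) k = 0 := by
  haveI := lev_neZero L k
  exact Qrem_zero_coeff (lev L k) L M (W (k + 1)) _

/-- **AT FLAT COEFFICIENTS THE COMPOSED REMAINDER VANISHES AT EVERY LEVEL** (induction on the recursion `Erem_succ`). [folklore] -/
theorem Erem_flatCoeff (W : (i : ℕ) → Fin d → (idx L M i → Matrix o o ℂ)) (k : ℕ) : Erem L M W (flatCoeff d L M o) k = 0 := by
  induction k with
  | zero => exact Erem_zero L M W _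
  | succ k ih => rw [Erem_succ, ih, QremStep_flatCoeff, Matrix.zero_mul, Matrix.mul_zero, add_zero, smul_zero]

/-- hence the composed FULL averaging is the composed main-term table averaging: `√(n_k^d)·Q^{full}_k = B_k + E_k(T_Bal)`. [folklore] -/
theorem sqrtVol_smul_QfullLev_flatCoeff (W : (i : ℕ) → Fin d → (idx L M i → Matrix o o ℂ)) (k : ℕ) :
    sqrtVol d L k • QfullLev L M W (flatCoeff d L M o) k = Bfree L M k + EcovT L M (fun k => TBal L M W k) k := by
  rw [← Bfree_add_EcovT_add_Erem, Erem_flatCoeff, add_zero]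

/-- at `W ≡ 1` and flat coefficients the remainder tower is the zero tower (the free case of `ComposedAveragingRemainder.avgPertFull`, cf. gen 4's `ComposedAveragingFlatWitness`). [folklore] -/
theorem Erem_one_flatCoeff : (fun k => Erem L M (fun _ _ _ => (1 : Matrix o o ℂ)) (flatCoeff d L M o) k) = fun _ => 0 := by
  funext k; exact Erem_flatCoeff L M _ k

end Summit.QuantumFields.BalabanUV.T4Continuum.NE2.ComposedRemainderFlatWitness

end
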